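import Literature.NumberTheory.EllipticCurves.AdditiveReductionRamifiedTorsionProofs
import Literature.NumberTheory.EllipticCurves.KodairaNeronUnramifiedInertiaProofs
import HarnessLib

/-!
# Additive reduction at `v ∤ p`: an inertia-fixed subgroup of `E[p]` has at most `4` points;
# at `p = 3` the inertia invariants `E[3]^{I_v}` are `0` or a LINE (theorems only)

`Proofs` file (theorems only: no definition, no named fact, no instance), topic
`NumberTheory/EllipticCurves`; the COUNTING refinement of the tree's
`WeierstrassCurve.exists_inertia_map_ne_of_hasAdditiveReduction` (`AdditiveReductionRamifiedTorsionProofs`: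
"at an additive `v ∤ p`, `p ≥ 3`, inertia moves SOME `p`-torsion point", i.e. `p² ≤ 4` is absurd).  Here
the same injection `E(K_v^nr)[p] ↪ E(K_v^nr)/E₀(K_v^nr)` (Silverman *AEC* Thm. VII.6.1, proof of VII.7.1;
the reduction is a cusp, so `E₀(K_v^nr)` has no `p`-torsion, `eq_zero_of_zsmul_eq_zero_of_cusp`; the index
is `≤ 4`, `index_nonsingularReductionSubgroup_map_le_four_of_isAdditive`, from Tate's algorithm PROVED in
the tree) is read as a BOUND on every inertia-fixed subgroup, for EVERY `p : ℕ` with `v ∤ p` (no primality):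

* `WeierstrassCurve.natCard_le_four_of_forall_inertia_map_eq_of_hasAdditiveReduction` — LOCAL (minimal
  `X/K_v`, additive): a subgroup `A ≤ X(K̄_v)` of `p`-torsion points fixed by `I_𝔐 ≤ Γ_{K_v}` has
  `#A ≤ 4`;
* `WeierstrassCurve.natCard_le_four_of_absInertia_fixed_of_hasAdditiveReductionAt`,
  `…natCard_dvd_three_…`, `…eq_bot_or_natCard_eq_three_…` — GLOBAL forms for `E/K` over a number
  field on `E[p] = geomTorsion W p ≤ E(K̄)`, the local inertia group `absInertia K_v` acting through
  `absGaloisRestrict K K_v` (the currency of `exists_line_le_geomTorsion_of_hasMultiplicativeReductionAt`).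

Consumer (cell `bsd-ssimc`, crux `KobayashiLowerHalfLargeImage`, item stmt-BirchSwinnertonDyer-19001,
line `shadow_seed`): its local lemma "at a Kodaira `IV`/`IV*` prime `q ≠ 3`, `E[3]|G_{ℚ_q} ≅ (μω ∗; 0 μ)`
ramified with unramified `μ`" says in particular that `E[3]^{I_q}` is a LINE.  The tree has: `E[3]` is
ramified at every additive `q ∤ 3` (`exists_smul_geomTorsion_ne_of_hasAdditiveReductionAt`) and
`E[3]^{I_q} = 0` unless `3 ∣ #Φ(k̄)` (types `IV`, `IV*`; Summits-side
`localPoints_eq_zero_of_absInertia_fixed_of_not_dvd_componentGroupOrder`).  This file adds "AT MOST a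
line"; "AT LEAST a line at `IV`/`IV*`" (`E(K_v^nr)[3] ≅ Φ(k̄)[3]`) and the Frobenius characters are NOT
proved here.  Nothing is asserted about any curve; BSD is not proved by any of this.

## References

* [SilvermanAEC2009] J. H. Silverman, *The Arithmetic of Elliptic Curves*, 2nd ed., GTM 106 (2009):
  Thm. VII.6.1, Cor. VII.6.2 (PDF p. 177), Prop. VII.2.1, VII.3.1, proof of Thm. VII.7.1 (PDF p. 179),
  Cor. III.6.4 (b).
* [SilvermanATAEC1994] J. H. Silverman, *Advanced Topics in the Arithmetic of Elliptic Curves*, GTM 151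
  (1994): Cor. IV.9.2 (d), Rem. IV.9.2.2, Table 4.1 (PDF pp. 340, 365), Thm. IV.10.2 (a) (PDF pp. 358–359).

Design: no definitions; one universe `u`; the local theorem reproduces the setting and steps (1)–(5a) of
`exists_inertia_map_ne_of_hasAdditiveReduction` VERBATIM (same binders and `maxHeartbeats`).
-/
noncomputable section

open scoped Classical NNReal
open NumberField IsDedekindDomain Field Polynomial IsLocalRing

universe u

namespace WeierstrassCurve

open Literature.NumberTheory.EllipticCurves Literature.NumberTheory.EllipticCurves.LocalIndex
  Literature.NumberTheory.GaloisRepresentations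
  Literature.NumberTheory.GaloisRepresentations.IsNonarchimedeanLocalField
  Literature.NumberTheory.DiophantineGeometry Literature.NumberTheory.DiophantineGeometry.TateAlgorithm
  IsDedekindDomain IsDedekindDomain.HeightOneSpectrum

section Local

variable {K : Type u} [Field K] [NumberField K] {v : HeightOneSpectrum (𝓞 K)}
  (X : WeierstrassCurve (v.adicCompletion K))

set_option maxHeartbeats 4000000 in
/-- **Additive reduction at `v ∤ p`: an inertia-fixed subgroup of `X(K̄_v)[p]` has at most `4`
points.**  For a minimal Weierstrass equation `X/K_v` with ADDITIVE reduction, `w` the spectral valuation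
of `K̄_v`, `𝔐` the prime of `\bar 𝓞_v` above `𝓂_v`, ANY `p : ℕ` with `v ∤ p` (no primality), and a subgroup
`A ≤ X(K̄_v)` of points killed by `p` and fixed by every `σ ∈ I_𝔐 ≤ Γ_{K_v}`: `#A ≤ 4` — `A` comes from
the `p`-torsion `T` of `J(K_v^nr)` (`J = X₀ ⊗ 𝒪ⁿʳ`), which meets `E₀` trivially (cusp) and so injects
into `J(K_v^nr)/E₀`, of order `≤ 4`.  Steps (1)–(5a) of `exists_inertia_map_ne_of_hasAdditiveReduction`.
[cite: SilvermanAEC2009, Thm. VII.6.1 with Cor. VII.6.2 (PDF p. 177) and proof of Thm. VII.7.1 (PDF p. 179)]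
[cite: SilvermanATAEC1994, Cor. IV.9.2(d) and Rem. IV.9.2.2 (PDF p. 340)] -/
theorem natCard_le_four_of_forall_inertia_map_eq_of_hasAdditiveReduction [hXell : X.IsElliptic]
    [hadd : X.HasAdditiveReduction (v.adicCompletionIntegers K)]
    (w : Valuation (AlgebraicClosure (v.adicCompletion K)) ℝ≥0)
    (hw : ∀ x, (w x : ℝ) =
      spectralNorm (v.adicCompletion K) (AlgebraicClosure (v.adicCompletion K)) x)
    {𝔐 : Ideal (localAbsIntegers v)} (h𝔐 : 𝔐 ∈ v.localPrimesAbove)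
    {p : ℕ} (hpv : (p : 𝓞 K) ∉ v.asIdeal)
    (A : AddSubgroup (X.baseChange (AlgebraicClosure (v.adicCompletion K))).toAffine.Point)
    (hAp : ∀ P ∈ A, p • P = 0)
    (hAI : ∀ σ ∈ 𝔐.inertia (absoluteGaloisGroup (v.adicCompletion K)), ∀ P ∈ A,
      Affine.Point.map ((absoluteGaloisGroup.toAlgEquiv _ σ :
          AlgebraicClosure (v.adicCompletion K) ≃ₐ[v.adicCompletion K]
            AlgebraicClosure (v.adicCompletion K)) :
          AlgebraicClosure (v.adicCompletion K) →ₐ[v.adicCompletion K]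
            AlgebraicClosure (v.adicCompletion K)) P = P) :
    Nat.card A ≤ 4 := by
  haveI hXmin : X.IsMinimal (v.adicCompletionIntegers K) := hadd.toIsMinimal
  letI instDec : DecidableEq (maxUnramified (v.adicCompletion K)) := fun a b => Classical.propDecidable (a = b)
  haveI := isDiscreteValuationRing_unrIntegers hw
  haveI := henselianLocalRing_unrIntegers hw
  haveI : PerfectField (ResidueField (v.adicCompletionIntegers K)) := PerfectField.ofFinite
  obtain ⟨φ, hφ⟩ := exists_ringHom_adicCompletionIntegers_unrIntegers hw
  obtain ⟨ψ, hψ⟩ := exists_ringHom_unrIntegers_integer (w := w)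
  have hvR := integers_valuationRing_valuation (Valuation.valuationSubring (Valuation.comap (algebraMap (maxUnramified (v.adicCompletion K)) (AlgebraicClosure (v.adicCompletion K))) w)) (maxUnramified (v.adicCompletion K))
  have hinjR := IsFractionRing.injective (Valuation.valuationSubring (Valuation.comap (algebraMap (maxUnramified (v.adicCompletion K)) (AlgebraicClosure (v.adicCompletion K))) w)) (maxUnramified (v.adicCompletion K))
  have hX₀K : (X.integralModel (v.adicCompletionIntegers K)).baseChange (v.adicCompletion K) = X :=
    WeierstrassCurve.baseChange_integralModel_eq (v.adicCompletionIntegers K) X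
  have hΔ : (X.integralModel (v.adicCompletionIntegers K)).Δ ≠ 0 := fun h0 ↦ by
    refine hXell.isUnit.ne_zero ?_
    rw [← hX₀K]
    change ((X.integralModel (v.adicCompletionIntegers K)).map (algebraMap _ _)).Δ = 0
    rw [WeierstrassCurve.map_Δ, h0, map_zero]
  /- (1) the index of `E₀` in `J(K_v^nr)`, `J = X₀ ⊗ 𝒪ⁿʳ`, is `≠ 0` and `≤ 4` (additive type) -/
  have hΔm : (X.integralModel (v.adicCompletionIntegers K)).Δ ∈ maximalIdeal (v.adicCompletionIntegers K) := by
    have h := hadd.badReduction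
    rw [← WeierstrassCurve.integralModel_Δ_eq (v.adicCompletionIntegers K) X] at h
    exact (valuation_lt_one_iff_mem _ _).mp h
  have hc₄m : (X.integralModel (v.adicCompletionIntegers K)).c₄ ∈ maximalIdeal (v.adicCompletionIntegers K) := by
    have h := hadd.additiveReduction
    rw [← WeierstrassCurve.integralModel_c₄_eq (v.adicCompletionIntegers K) X] at h
    exact (valuation_lt_one_iff_mem _ _).mp h
  have hmin : ((X.integralModel (v.adicCompletionIntegers K)).baseChange (v.adicCompletion K)).IsMinimal (v.adicCompletionIntegers K) := by
    rw [hX₀K]; exact hXmin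
  have hsym : (X.integralModel (v.adicCompletionIntegers K)).kodairaSymbolOfMinimal.IsAdditive :=
    (isAdditive_kodairaSymbolOfMinimal_iff (v.adicCompletion K) hΔ hmin).mpr ⟨hΔm, hc₄m⟩
  have hfin : (((X.integralModel (v.adicCompletionIntegers K)).map φ).nonsingularReductionSubgroup hvR).index ≠ 0 :=
    index_nonsingularReductionSubgroup_map_ne_zero_of_isAdditive hw hφ _ hΔ hsym
  have hle4 : (((X.integralModel (v.adicCompletionIntegers K)).map φ).nonsingularReductionSubgroup hvR).index ≤ 4 :=
    index_nonsingularReductionSubgroup_map_le_four_of_isAdditive hw hφ _ hΔ hsym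
  /- the model `J = X₀ ⊗ 𝒪ⁿʳ`, its base changes to `K_v^nr` and to `𝒪_w`, `K̄_v` -/
  have hJ : ((X.integralModel (v.adicCompletionIntegers K)).map φ).baseChange (maxUnramified (v.adicCompletion K)) = X.baseChange (maxUnramified (v.adicCompletion K)) := by
    conv_rhs => rw [← hX₀K]
    change ((X.integralModel (v.adicCompletionIntegers K)).map φ).map (algebraMap _ _) =
      ((X.integralModel (v.adicCompletionIntegers K)).map (algebraMap (v.adicCompletionIntegers K) (v.adicCompletion K))).map (algebraMap (v.adicCompletion K) (maxUnramified (v.adicCompletion K)))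
    rw [WeierstrassCurve.map_map, WeierstrassCurve.map_map]
    congr 1
    refine RingHom.ext fun a ↦ Subtype.ext ?_
    change (((φ a : (Valuation.valuationSubring (Valuation.comap (algebraMap (maxUnramified (v.adicCompletion K)) (AlgebraicClosure (v.adicCompletion K))) w))) : (maxUnramified (v.adicCompletion K))) : (AlgebraicClosure (v.adicCompletion K))) = ((algebraMap (v.adicCompletion K) (maxUnramified (v.adicCompletion K)) (algebraMap (v.adicCompletionIntegers K) (v.adicCompletion K) a) : (maxUnramified (v.adicCompletion K))) : (AlgebraicClosure (v.adicCompletion K)))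
    rw [hφ, IntermediateField.coe_algebraMap_apply]
    rfl
  have hW₀ : (((X.integralModel (v.adicCompletionIntegers K)).map φ).map ψ).baseChange (AlgebraicClosure (v.adicCompletion K)) = X.baseChange (AlgebraicClosure (v.adicCompletion K)) := by
    conv_rhs => rw [← hX₀K]
    change (((X.integralModel (v.adicCompletionIntegers K)).map φ).map ψ).map (algebraMap _ _) =
      ((X.integralModel (v.adicCompletionIntegers K)).map (algebraMap (v.adicCompletionIntegers K) (v.adicCompletion K))).map (algebraMap (v.adicCompletion K) (AlgebraicClosure (v.adicCompletion K)))
    rw [WeierstrassCurve.map_map, WeierstrassCurve.map_map, WeierstrassCurve.map_map]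
    congr 1
    refine RingHom.ext fun a ↦ ?_
    change ((ψ (φ a) : w.integer) : (AlgebraicClosure (v.adicCompletion K))) = algebraMap (v.adicCompletion K) (AlgebraicClosure (v.adicCompletion K)) (algebraMap (v.adicCompletionIntegers K) (v.adicCompletion K) a)
    rw [hψ, hφ]
    rfl
  -- the residue field of `𝒪ⁿʳ` embeds into that of `𝒪_w`
  haveI hψloc : IsLocalHom ψ := ⟨fun a ha ↦ by
    by_contra hna
    have hmem : a ∈ maximalIdeal (Valuation.valuationSubring (Valuation.comap (algebraMap (maxUnramified (v.adicCompletion K)) (AlgebraicClosure (v.adicCompletion K))) w)) :=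
      (IsLocalRing.mem_maximalIdeal _).mpr (mem_nonunits_iff.mpr hna)
    have := (map_mem_maximalIdeal_integer_iff hψ a).mpr hmem
    exact (mem_nonunits_iff.mp ((IsLocalRing.mem_maximalIdeal _).mp this)) ha⟩
  have hκ : (((X.integralModel (v.adicCompletionIntegers K)).map φ).map ψ).map (residue w.integer) =
      ((((X.integralModel (v.adicCompletionIntegers K)).map φ).map (residue (Valuation.valuationSubring (Valuation.comap (algebraMap (maxUnramified (v.adicCompletion K)) (AlgebraicClosure (v.adicCompletion K))) w)))).map
        (IsLocalRing.ResidueField.map ψ)) := by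
    simp only [WeierstrassCurve.map_map]
    congr 1
  /- the maps on points: `J(K_v^nr) ≃ X(K_v^nr) → X(K̄_v)` -/
  set e₁ := WeierstrassCurve.Affine.Point.congrEquiv hJ with he₁
  set ι : (X.baseChange (maxUnramified (v.adicCompletion K))).toAffine.Point →+ (X.baseChange (AlgebraicClosure (v.adicCompletion K))).toAffine.Point :=
    WeierstrassCurve.Affine.Point.map (W' := X)
      (IsScalarTower.toAlgHom (v.adicCompletion K) (maxUnramified (v.adicCompletion K)) (AlgebraicClosure (v.adicCompletion K))) with hι
  -- (3) `I_𝔐`-fixed points of `X(K̄_v)` come from `X(K_v^nr)` (the tree's exported Step (3))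
  have hsurj : ∀ P : (X.baseChange (AlgebraicClosure (v.adicCompletion K))).toAffine.Point,
      (∀ σ ∈ 𝔐.inertia (absoluteGaloisGroup (v.adicCompletion K)),
        WeierstrassCurve.Affine.Point.map
          ((absoluteGaloisGroup.toAlgEquiv _ σ : (AlgebraicClosure (v.adicCompletion K)) ≃ₐ[(v.adicCompletion K)] (AlgebraicClosure (v.adicCompletion K))) : (AlgebraicClosure (v.adicCompletion K)) →ₐ[(v.adicCompletion K)] (AlgebraicClosure (v.adicCompletion K))) P = P) →
        ∃ Q, ι Q = P := fun P hP ↦ by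
    rw [hι]; exact X.exists_map_maxUnramified_eq_of_forall_inertia w hw h𝔐 P hP
  -- (4) `E₀` of `J` over `𝒪ⁿʳ` maps into `E₀` of `X` over `𝒪_w`
  have hE₀ : ∀ Q : (((X.integralModel (v.adicCompletionIntegers K)).map φ).baseChange (maxUnramified (v.adicCompletion K))).toAffine.Point,
      ((X.integralModel (v.adicCompletionIntegers K)).map φ).HasNonsingularReduction Q →
        ReducesToNonsingular w (residue w.integer) (ι (e₁ Q)) := by
    intro Q hQ
    rcases point_cases hvR Q with rfl | ⟨x, y, h, rfl, hx⟩ | ⟨a, b, h, rfl⟩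
    · rw [map_zero, map_zero]; exact reducesToNonsingular_zero
    · have hx' : 1 < w (x : (AlgebraicClosure (v.adicCompletion K))) := not_le.mp fun hle ↦
        (not_mem_range_iff hvR).mpr hx ⟨⟨x, (Valuation.mem_valuationSubring_iff _ _).mpr hle⟩, rfl⟩
      rw [he₁, WeierstrassCurve.Affine.Point.congrEquiv_some]
      exact reducesToNonsingular_of_one_lt hx'
    · have hns := (WeierstrassCurve.hasNonsingularReduction_some_algebraMap_iff hinjR h).mp hQ
      rw [he₁, WeierstrassCurve.Affine.Point.congrEquiv_some]
      -- transport to the `𝒪_w`-model `J ⊗ 𝒪_w` of `X ⊗ K̄ᵥ`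
      rw [← (WeierstrassCurve.Affine.Point.congrEquiv hW₀).apply_symm_apply (ι _),
        reducesToNonsingular_congrEquiv_iff, reducesToNonsingular_iff_hasNonsingularReduction]
      change (((X.integralModel (v.adicCompletionIntegers K)).map φ).map ψ).HasNonsingularReduction
        ((WeierstrassCurve.Affine.Point.congrEquiv hW₀).symm
          (WeierstrassCurve.Affine.Point.some _ _ _))
      rw [WeierstrassCurve.Affine.Point.congrEquiv_symm_some]
      refine Or.inr ⟨ψ a, ψ b, hψ a, hψ b, ?_⟩
      rw [hκ, ← IsLocalRing.ResidueField.map_residue, ← IsLocalRing.ResidueField.map_residue]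
      exact (WeierstrassCurve.Affine.map_nonsingular _
        (IsLocalRing.ResidueField.map ψ).injective _ _).mpr hns
  /- (5) the count.  `T` = the `p`-torsion of `J(K_v^nr)`; `H = E₀`. -/
  set H := ((X.integralModel (v.adicCompletionIntegers K)).map φ).nonsingularReductionSubgroup hvR with hH
  set T := AddSubgroup.torsionBy
    ((((X.integralModel (v.adicCompletionIntegers K)).map φ).baseChange
      (maxUnramified (v.adicCompletion K))).toAffine.Point) (p : ℤ) with hT
  have hpw : w ((p : ℤ) : AlgebraicClosure (v.adicCompletion K)) = 1 :=
    spectralValuation_intCast_eq_one hw (n := (p : ℤ)) (by simpa using hpv)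
  haveI : CharZero (v.adicCompletion K) := charZero_of_injective_algebraMap (algebraMap K _).injective
  haveI : CharZero (AlgebraicClosure (v.adicCompletion K)) :=
    charZero_of_injective_algebraMap (algebraMap (v.adicCompletion K) _).injective
  -- the `𝒪_w`-model `W₀ = J ⊗ 𝒪_w` of `X ⊗ K̄_v` reduces to a CUSP
  have hv0 : w.Integers w.integer := Valuation.integer.integers w
  have T1 : ∀ (a : (v.adicCompletionIntegers K)), a ∈ maximalIdeal (v.adicCompletionIntegers K) →
      IsLocalRing.residue w.integer (ψ (φ a)) = 0 := by
    intro a ha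
    have h1 := (map_mem_maximalIdeal_pow_iff hw hφ a 1).mpr (by rwa [pow_one])
    rw [pow_one] at h1
    exact (IsLocalRing.residue_eq_zero_iff _).mpr ((map_mem_maximalIdeal_integer_iff hψ (φ a)).mpr h1)
  have hΔ0 : IsLocalRing.residue w.integer
      (((X.integralModel (v.adicCompletionIntegers K)).map φ).map ψ).Δ = 0 := by
    rw [WeierstrassCurve.map_Δ, WeierstrassCurve.map_Δ]; exact T1 _ hΔm
  have hc₄0 : IsLocalRing.residue w.integer
      (((X.integralModel (v.adicCompletionIntegers K)).map φ).map ψ).c₄ = 0 := by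
    rw [WeierstrassCurve.map_c₄, WeierstrassCurve.map_c₄]; exact T1 _ hc₄m
  -- the maps `J(K_v^nr) → X(K̄_v)` are injective
  have hinjι' : Function.Injective ι := by rw [hι]; exact WeierstrassCurve.Affine.Point.map_injective _
  have hinj : Function.Injective (fun Q => ι (e₁ Q)) := fun a b hab => e₁.injective (hinjι' hab)
  -- (5a) `T ⊓ H = ⊥`: a `p`-torsion point of `E₀(J)` is `O` (cusp)
  have hTH : ∀ Q, Q ∈ T → Q ∈ H → Q = 0 := by
    intro Q hQT hQH
    have hpQ : (p : ℤ) • Q = 0 := (Submodule.mem_torsionBy_iff (p : ℤ) Q).mp hQT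
    have hred : ReducesToNonsingular w (residue w.integer) (ι (e₁ Q)) := hE₀ Q hQH
    set P' := (WeierstrassCurve.Affine.Point.congrEquiv hW₀).symm (ι (e₁ Q)) with hP'
    have hns : (((X.integralModel (v.adicCompletionIntegers K)).map φ).map ψ).HasNonsingularReduction P' := by
      rw [← reducesToNonsingular_iff_hasNonsingularReduction]
      refine (reducesToNonsingular_congrEquiv_iff _ hW₀ P').mp ?_
      rw [hP', AddEquiv.apply_symm_apply]
      exact hred
    have hpP' : (p : ℤ) • P' = 0 := by
      rw [hP', ← map_zsmul, ← map_zsmul, ← map_zsmul, hpQ, map_zero, map_zero, map_zero]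
    have hP'0 : P' = 0 := eq_zero_of_zsmul_eq_zero_of_cusp _ hΔ0 hc₄0 hpw hns hpP'
    have h1 := congrArg (WeierstrassCurve.Affine.Point.congrEquiv hW₀) hP'0
    rw [hP', AddEquiv.apply_symm_apply, map_zero] at h1
    exact hinj (by simpa using h1)
  -- (5b) NEW: every point of the inertia-fixed subgroup `A` comes from `T`
  have hlift : ∀ P : A, ∃ Q : T, ι (e₁ (Q : _)) = (P : _) := by
    intro P
    have hpP : p • (P.1 : (X.baseChange (AlgebraicClosure (v.adicCompletion K))).toAffine.Point) = 0 :=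
      hAp P.1 P.2
    obtain ⟨P₀, hP₀⟩ := hsurj P.1 (fun σ hσ => hAI σ hσ P.1 P.2)
    refine ⟨⟨e₁.symm P₀, ?_⟩, by rw [AddEquiv.apply_symm_apply, hP₀]⟩
    refine (Submodule.mem_torsionBy_iff (p : ℤ) _).mpr ?_
    apply hinj
    change ι (e₁ ((p : ℤ) • e₁.symm P₀)) = ι (e₁ 0)
    rw [map_zsmul, map_zsmul, AddEquiv.apply_symm_apply, hP₀, map_zero, map_zero, natCast_zsmul, hpP]
  choose f hf using hlift
  have hfinj : Function.Injective f := fun P₁ P₂ h => Subtype.ext (by rw [← hf P₁, ← hf P₂, h])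
  -- (5c) `T ↪ J(K_v^nr)/H`
  haveI hfinQ : Finite ((((X.integralModel (v.adicCompletionIntegers K)).map φ).baseChange
      (maxUnramified (v.adicCompletion K))).toAffine.Point ⧸ H) :=
    Nat.finite_of_card_ne_zero (by rw [← AddSubgroup.index_eq_card]; exact hfin)
  set g : T → ((((X.integralModel (v.adicCompletionIntegers K)).map φ).baseChange
      (maxUnramified (v.adicCompletion K))).toAffine.Point ⧸ H) :=
    fun Q => (QuotientAddGroup.mk Q.1 : _ ⧸ H) with hg
  have hginj : Function.Injective g := by
    intro Q₁ Q₂ h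
    apply Subtype.ext
    have h' : (QuotientAddGroup.mk Q₁.1 : _ ⧸ H) = QuotientAddGroup.mk Q₂.1 := h
    rw [QuotientAddGroup.eq] at h'
    have hmem : -Q₁.1 + Q₂.1 ∈ T := T.add_mem (T.neg_mem Q₁.2) Q₂.2
    have h0 := hTH _ hmem h'
    rwa [neg_add_eq_zero] at h0
  haveI hfinT : Finite T := Finite.of_injective g hginj
  -- the count: `#A ≤ #T ≤ [J : H] ≤ 4`
  have h1 : Nat.card A ≤ Nat.card T := Nat.card_le_card_of_injective f hfinj
  have h2 : Nat.card T ≤ H.index := by rw [AddSubgroup.index_eq_card]; exact Nat.card_le_card_of_injective g hginj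
  omega

end Local

/-! ### The statements for an elliptic curve over a number field -/

section Global

open Literature.NumberTheory.EllipticCurves Literature.NumberTheory.GaloisRepresentations Field
  IsDedekindDomain.HeightOneSpectrum

variable {K : Type u} [Field K] [NumberField K] {v : HeightOneSpectrum (𝓞 K)}
  (W : WeierstrassCurve K)

/-- **Additive reduction at `v ∤ p`: a subgroup of `E[p]` fixed by the local inertia group has at most
`4` points.**  For `E/K` elliptic over a number field, any `p : ℕ`, a finite place `v ∤ p` of ADDITIVE
reduction, and a subgroup `A ≤ E[p] ≤ E(K̄)` fixed pointwise by `absInertia K_v ≤ Γ_{K_v}` (through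
`absGaloisRestrict K K_v`): `#A ≤ 4` — transport of the local theorem along the chosen embedding
`K̄ → K̄_v` (`pointsMapOfEmb`) and the equivariant isomorphism with the minimal model at `v`
(`exists_addEquiv_localPoints_of_smul_eq`; `I_𝔐 = absInertia K_v`, `inertia_eq_absInertia`).
[cite: SilvermanAEC2009, Thm. VII.6.1 (PDF p. 177) and proof of Thm. VII.7.1 (PDF p. 179)]
[cite: SilvermanATAEC1994, Thm. IV.10.2(a), additive case (PDF pp. 358–359)] -/
theorem natCard_le_four_of_absInertia_fixed_of_hasAdditiveReductionAt [W.IsElliptic]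
    (hadd : W.HasAdditiveReductionAt v) {p : ℕ} (hpv : (p : 𝓞 K) ∉ v.asIdeal)
    (A : AddSubgroup (geomPoints W)) (hAp : A ≤ geomTorsion W (p : ℤ))
    (hAI : ∀ σ ∈ absInertia (v.adicCompletion K), ∀ P ∈ A,
      absGaloisRestrict K (v.adicCompletion K) σ • P = P) :
    Nat.card A ≤ 4 := by
  obtain ⟨w, hw⟩ := v.exists_spectralValuation
  obtain ⟨𝔐, h𝔐⟩ := v.localPrimesAbove_nonempty
  set X := W.localMinimalModel v with hXdef
  haveI : X.IsElliptic := W.isElliptic_localMinimalModel v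
  haveI : X.HasAdditiveReduction (v.adicCompletionIntegers K) := hadd
  obtain ⟨C, hC⟩ := W.exists_variableChange_smul_eq_localMinimalModel v
  obtain ⟨Φ, hΦ⟩ := W.exists_addEquiv_localPoints_of_smul_eq v hC
  -- the injection `F = Φ ∘ ι_*` for the chosen embedding `ι : K̄ → K̄_v`
  set ι : AlgebraicClosure K →ₐ[K] AlgebraicClosure (v.adicCompletion K) :=
    closureEmb (K := K) (v.adicCompletion K) with hι
  let F : geomPoints W →+ (X.baseChange (AlgebraicClosure (v.adicCompletion K))).toAffine.Point :=
    Φ.toAddMonoidHom.comp (pointsMapOfEmb W ι)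
  have hFapply : ∀ P : geomPoints W, F P = Φ (pointsMapOfEmb W ι P) := fun _ ↦ rfl
  have hFinj : Function.Injective F := fun P Q hPQ ↦ by
    rw [hFapply, hFapply] at hPQ
    exact pointsMapOfEmb_injective W ι (Φ.injective hPQ)
  -- the image subgroup is `p`-torsion and `I_𝔐`-fixed
  have hAp' : ∀ P ∈ A.map F, p • P = 0 := by
    rintro _ ⟨P, hP, rfl⟩
    have h : (p : ℤ) • P = 0 := (mem_geomTorsion_iff W (p : ℤ) P).mp (hAp hP)
    rw [← natCast_zsmul, ← map_zsmul, h, map_zero]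
  have hAI' : ∀ σ ∈ 𝔐.inertia (absoluteGaloisGroup (v.adicCompletion K)), ∀ P ∈ A.map F,
      Affine.Point.map ((absoluteGaloisGroup.toAlgEquiv _ σ :
          AlgebraicClosure (v.adicCompletion K) ≃ₐ[v.adicCompletion K]
            AlgebraicClosure (v.adicCompletion K)) :
          AlgebraicClosure (v.adicCompletion K) →ₐ[v.adicCompletion K]
            AlgebraicClosure (v.adicCompletion K)) P = P := by
    rintro σ hσ _ ⟨P, hP, rfl⟩
    rw [inertia_eq_absInertia hw h𝔐] at hσ
    rw [hFapply, ← hΦ σ, ← pointsMapOfEmb_smul]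
    congr 2
    have hres : resGalOfEmb ι σ = absGaloisRestrict K (v.adicCompletion K) σ := rfl
    rw [hres]
    exact hAI σ hσ P hP
  have hcard : Nat.card (A.map F) = Nat.card A := AddSubgroup.card_map_of_injective hFinj
  rw [← hcard]
  exact X.natCard_le_four_of_forall_inertia_map_eq_of_hasAdditiveReduction w hw h𝔐 hpv
    (A.map F) hAp' hAI'

/-- **`p = 3`: a subgroup of `E[3]` fixed by the local inertia group at an additive `v ∤ 3` has order
dividing `3`** (`0` or a line): `A ≤ E[3]` fixed pointwise by `absInertia K_v`, `v ∤ 3` additive ⇒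
`#A ∣ 3`, from `#A ≤ 4` and `#A ∣ #E[3] = 9`.
[cite: SilvermanAEC2009, Thm. VII.6.1 (PDF p. 177), Cor. III.6.4(b)]
[cite: SilvermanATAEC1994, Thm. IV.10.2(a), additive case (PDF pp. 358–359)] -/
theorem natCard_dvd_three_of_absInertia_fixed_of_hasAdditiveReductionAt [W.IsElliptic]
    (hadd : W.HasAdditiveReductionAt v) (h3v : (3 : 𝓞 K) ∉ v.asIdeal)
    (A : AddSubgroup (geomPoints W)) (hA3 : A ≤ geomTorsion W (3 : ℤ))
    (hAI : ∀ σ ∈ absInertia (v.adicCompletion K), ∀ P ∈ A,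
      absGaloisRestrict K (v.adicCompletion K) σ • P = P) :
    Nat.card A ∣ 3 := by
  have hle4 : Nat.card A ≤ 4 :=
    W.natCard_le_four_of_absInertia_fixed_of_hasAdditiveReductionAt hadd
      (by exact_mod_cast h3v) A (by exact_mod_cast hA3) hAI
  have h9 : Nat.card (geomTorsion W ((3 : ℕ) : ℤ)) = 3 ^ 2 :=
    card_torsionBy_eq_sq (E := W.baseChange (AlgebraicClosure K)) (n := 3) (by norm_num)
  have hdvd : Nat.card A ∣ 3 ^ 2 := h9 ▸ AddSubgroup.card_dvd_of_le (by exact_mod_cast hA3)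
  obtain ⟨k, hk, hkA⟩ := (Nat.dvd_prime_pow Nat.prime_three).mp hdvd
  rw [hkA] at hle4 ⊢
  interval_cases k
  · exact one_dvd _
  · exact dvd_rfl
  · norm_num at hle4

/-- **`E[3]^{I_v}` is `0` or a LINE at an additive `v ∤ 3`**: a subgroup `A ≤ E[3]` fixed pointwise by
the local inertia group `absInertia K_v` is trivial or has exactly `3` points (the tree's
`exists_smul_geomTorsion_ne_of_hasAdditiveReductionAt` says `A ≠ E[3]`; the complementary EXISTENCE
"`#E[3]^{I_v} = 3` at Kodaira types `IV`, `IV*`" is not proved here).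
[cite: SilvermanAEC2009, Thm. VII.6.1 (PDF p. 177) and proof of Thm. VII.7.1 (PDF p. 179)]
[cite: SilvermanATAEC1994, Cor. IV.9.2(d) with Table 4.1 (PDF pp. 340, 365)] -/
theorem eq_bot_or_natCard_eq_three_of_absInertia_fixed_of_hasAdditiveReductionAt [W.IsElliptic]
    (hadd : W.HasAdditiveReductionAt v) (h3v : (3 : 𝓞 K) ∉ v.asIdeal)
    (A : AddSubgroup (geomPoints W)) (hA3 : A ≤ geomTorsion W (3 : ℤ))
    (hAI : ∀ σ ∈ absInertia (v.adicCompletion K), ∀ P ∈ A,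
      absGaloisRestrict K (v.adicCompletion K) σ • P = P) :
    A = ⊥ ∨ Nat.card A = 3 := by
  have hdvd := W.natCard_dvd_three_of_absInertia_fixed_of_hasAdditiveReductionAt hadd h3v A hA3 hAI
  rcases (Nat.dvd_prime Nat.prime_three).mp hdvd with h1 | h3
  · exact Or.inl (AddSubgroup.eq_bot_of_card_eq A h1)
  · exact Or.inr h3

end Global

end WeierstrassCurve

end
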